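import Summits.Ventures.LatticeQCDFlow.Exactness.IMHCoupledUnbiasedEstimatorVariance
import HarnessLib

/-!
# The mean-square error of the coupled unbiased estimator from every start: at most one equilibrium draw's variance
# plus `(1 − A)^k (c − a)² (2W² + W + 1)` — no burn-in bias, and a geometrically small price for it

HONEST FRAMING: exact (Metropolis-corrected) sampling algorithms for lattice gauge theory;
figures of merit are autocorrelation/cost numbers at stated couplings and volumes; no
continuum-physics claim.

Venture `LatticeQCDFlow` (cell pub-lqcd), topic `Exactness`; FANOUT row 30 (lean-1, GEN-37).  NEW WORK of the cell,
general state space; sequel to `Exactness/IMHCoupledUnbiasedEstimatorVariance` (this generation).  Setting as there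
(`K = indepMH q w`, `w` measurable — a `Fact` —, positive, normalised, maximal at `x₀`, `W = w(x₀) = 1/A`, `r = 1 − A`; CRN pair
kernel `K̂`, pair path law from an initial coupling `μ̂₀`, `μ₂ = μ̂₀∘snd⁻¹`; `a ≤ f ≤ c` measurable, `π(f) = ∫ f dπ`,
`Var_π f = ∫ (f − π f)² dπ`, `D = max(π f − a, c − π f)`; the truncated coupled estimator `H_{k,N} = f(Y_k) + Σ_{n<N} D_{k+n}`,
`D_n = f(X′_n) − f(Y_n)`):

* §1 **`crnLag_truncated_sq_le`** — FROM EVERY INITIAL COUPLING (no lag condition needed):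
  `E(H_{k,N} − π f)² ≤ ∫ (f − π f)² d(μ₂K^k) + r^k·(c − a)²·W(2W + 1)` — the single-time error of the plain run at time `k` plus
  the price of the corrections (cross term `≤ 2(c − a)Σ_{n<N} E|D_{k+n}| ≤ 2r^k(c − a)²W`, square term `≤ r^k(c − a)²W(2W − 1)`
  from the Variance file).
* §2 **`integral_sq_sub_iterate_bind_indepMH_mem_Icc`** — THE SINGLE-TIME ERROR FROM EVERY START: for every initial law `μ₀`
  and every `n`, `∫ (f − π f)² d(μ₀Kⁿ) ∈ [(1 − rⁿ)·Var_π f, (1 − rⁿ)·Var_π f + rⁿ·D²]` (the exact split `μ₀Kⁿ = (1 − rⁿ)π + rⁿν`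
  of `IMHAnyStartSplit`; `(f − π f)² ≤ D²`); **`integral_sq_sub_iterate_bind_indepMH_le`** — `≤ Var_π f + rⁿ·D²`.
* §3 **`crnLag_truncated_sq_le_variance`** — hence FROM EVERY START
  `E(H_{k,N} − π f)² ≤ (1 − r^k)·Var_π f + r^k·(D² + (c − a)²W(2W + 1)) ≤ Var_π f + r^k·(c − a)²·(2W² + W + 1)`
  (**`crnLag_truncated_sq_le_variance'`**); **`crnLag_truncated_sq_le_of_log_le`** — so `k·A ≥ log((2W² + W + 1)/ε)` lagged
  updates give `E(H_{k,N} − π f)² ≤ Var_π f + ε·(c − a)²` for EVERY `N` (and the bias is `≤ r^{k+N}(c − a)`, zero at `N = ∞`);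
  **`crnLag_truncated_sq_le_dirac`** — the same from every starting configuration `x` (`μ̂₀ = (δ_x K) ⊗ δ_x`).
Reading (gauge files): the coupled estimator of an exact gauge sampler has NO burn-in bias and, after a lag of
`≈ W·log(W²/ε)` updates, the mean-square error of ONE equilibrium draw up to `ε(c − a)²`; `R` independent pairs averaged divide
it by `R` — embarrassingly parallel, with no bias floor.
NOT CLAIMED: the exact variance of `H_{k,N}`; the time-averaged estimator (next file); optimality of `2W² + W + 1`; anything for
unbounded `f`.  No `sorry`, no new definitions, nothing cited as a fact.
-/

noncomputable section

namespace Summit.Ventures.LatticeQCDFlow.Exactness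

open MeasureTheory ProbabilityTheory Function Finset
open scoped ENNReal unitInterval
open Summit.Ventures.LatticeQCDFlow.Scoring

variable {Ω : Type*} [MeasurableSpace Ω] {q : Measure Ω} [IsProbabilityMeasure q] {w : Ω → ℝ}

/-! ## §1 The mean-square error of the truncated estimator against the single-time error at time `k` -/

/-- **THE MEAN-SQUARE ERROR OF THE COUPLED ESTIMATOR**: `w` measurable (a `Fact`), positive, normalised, maximal at `x₀`
(`W = w(x₀)`, `r = 1 − 1/W`); `K̂` a CRN pair kernel; `a ≤ f ≤ c` measurable; ANY initial coupling `μ̂₀` (`μ₂ = μ̂₀∘snd⁻¹`;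
no lag condition is needed for this bound).  For every `k`, `N`:
`E[(f(Y_k) + Σ_{n<N} D_{k+n} − π(f))²] ≤ ∫ (f − π(f))² d(μ₂K^k) + r^k·(c − a)²·W(2W + 1)` — the single-time error of the plain
run at time `k` plus a geometrically small price for removing the bias. [ours] -/
theorem crnLag_truncated_sq_le [Fact (Measurable w)] (hw0 : ∀ y, 0 < w y) {x₀ : Ω} (hmax : ∀ y, w y ≤ w x₀)
    [IsProbabilityMeasure (q.withDensity fun y => ENNReal.ofReal (w y))]
    (Khat : Kernel (Ω × Ω) (Ω × Ω)) [IsMarkovKernel Khat]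
    (hK : ∀ z : Ω × Ω, Khat z = (q.prod (volume : Measure unitInterval)).map (fun p : Ω × unitInterval =>
      ((if (p.2 : ℝ) * w z.1 ≤ w p.1 then p.1 else z.1), (if (p.2 : ℝ) * w z.2 ≤ w p.1 then p.1 else z.2))))
    (μ₀ : Measure (Ω × Ω)) [IsProbabilityMeasure μ₀] {f : Ω → ℝ} (hf : Measurable f) {a c : ℝ}
    (ha : ∀ x, a ≤ f x) (hc : ∀ x, f x ≤ c) (k N : ℕ) :
    ∫ z, (f ((z k).2) + ∑ n ∈ Finset.range N, (f ((z (k + n)).1) - f ((z (k + n)).2)) -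
          ∫ x, f x ∂(q.withDensity fun y => ENNReal.ofReal (w y))) ^ 2
        ∂(Kernel.trajMeasure (X := fun _ : ℕ => Ω × Ω) μ₀
          (fun n : ℕ => Khat.comap (fun h : (i : ↥(Finset.Iic n)) → Ω × Ω => h ⟨n, Finset.mem_Iic.2 le_rfl⟩)
            (measurable_pi_apply _))) ≤
      ∫ y, (f y - ∫ x, f x ∂(q.withDensity fun y => ENNReal.ofReal (w y))) ^ 2
          ∂((fun m : Measure Ω => m.bind (indepMH q w))^[k] (μ₀.map Prod.snd)) +
        (1 - (w x₀)⁻¹) ^ k * (c - a) ^ 2 * (w x₀ * (2 * w x₀ + 1)) := by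
  haveI : IsProbabilityMeasure (μ₀.map Prod.snd) := Measure.isProbabilityMeasure_map measurable_snd.aemeasurable
  set P := Kernel.trajMeasure (X := fun _ : ℕ => Ω × Ω) μ₀
        (fun n : ℕ => Khat.comap (fun h : (i : ↥(Finset.Iic n)) → Ω × Ω => h ⟨n, Finset.mem_Iic.2 le_rfl⟩)
          (measurable_pi_apply _)) with hP
  set π : Measure Ω := q.withDensity fun y => ENNReal.ofReal (w y) with hπ
  set m : ℝ := ∫ x, f x ∂π with hm
  -- `m ∈ [a, c]`, so `|f − m| ≤ c − a`
  have hC : ∀ x, |f x| ≤ max |a| |c| := fun x => abs_le_max_abs_abs (ha x) (hc x)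
  have hfi : Integrable f π := integrable_of_bounded π hf hC
  have hma : a ≤ m := by
    have := integral_mono (integrable_const a) hfi ha; rwa [integral_const, probReal_univ, one_smul] at this
  have hmc : m ≤ c := by
    have := integral_mono hfi (integrable_const c) hc; rwa [integral_const, probReal_univ, one_smul] at this
  have hXb : ∀ y, |f y - m| ≤ c - a := fun y => by
    have h1 := ha y; have h2 := hc y
    exact abs_le.2 ⟨by linarith, by linarith⟩
  have hca : 0 ≤ c - a := by linarith
  have hW : 1 ≤ w x₀ := one_le_of_mode (q := q) hmax
  have hWpos : 0 < w x₀ := hw0 x₀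
  have hr0 : 0 ≤ 1 - (w x₀)⁻¹ := sub_nonneg.2 (inv_le_one_of_one_le₀ hW)
  have hr1 : 1 - (w x₀)⁻¹ < 1 := sub_lt_self _ (inv_pos.mpr hWpos)
  -- the three path functionals: `X = f(Y_k) − m`, `S = Σ D`, `T = Σ |D|`
  have hXm : Measurable (fun z : ℕ → Ω × Ω => f ((z k).2) - m) :=
    (hf.comp (measurable_snd.comp (measurable_pi_apply k))).sub measurable_const
  have hDm' : ∀ n, Measurable (fun z : ℕ → Ω × Ω => f ((z n).1) - f ((z n).2)) := fun n =>
    (hf.comp (measurable_fst.comp (measurable_pi_apply n))).sub (hf.comp (measurable_snd.comp (measurable_pi_apply n)))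
  have hDb : ∀ n (z : ℕ → Ω × Ω), |f ((z n).1) - f ((z n).2)| ≤ c - a := by
    intro n z
    have h1 := ha ((z n).1); have h2 := hc ((z n).1); have h3 := ha ((z n).2); have h4 := hc ((z n).2)
    exact abs_le.2 ⟨by linarith, by linarith⟩
  have hSm : Measurable (fun z : ℕ → Ω × Ω => ∑ n ∈ range N, (f ((z (k + n)).1) - f ((z (k + n)).2))) :=
    Finset.measurable_sum _ fun n _ => hDm' (k + n)
  have hTm : Measurable (fun z : ℕ → Ω × Ω => ∑ n ∈ range N, |f ((z (k + n)).1) - f ((z (k + n)).2)|) :=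
    Finset.measurable_sum _ fun n _ => (hDm' (k + n)).abs
  have hST : ∀ z : ℕ → Ω × Ω, |∑ n ∈ range N, (f ((z (k + n)).1) - f ((z (k + n)).2))| ≤
      ∑ n ∈ range N, |f ((z (k + n)).1) - f ((z (k + n)).2)| := fun z => abs_sum_le_sum_abs _ _
  have hTb : ∀ z : ℕ → Ω × Ω, ∑ n ∈ range N, |f ((z (k + n)).1) - f ((z (k + n)).2)| ≤ N * (c - a) := by
    intro z
    refine (sum_le_sum fun n _ => hDb (k + n) z).trans_eq ?_
    rw [sum_const, card_range, nsmul_eq_mul]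
  have hTnn : ∀ z : ℕ → Ω × Ω, 0 ≤ ∑ n ∈ range N, |f ((z (k + n)).1) - f ((z (k + n)).2)| := fun z =>
    sum_nonneg fun n _ => abs_nonneg _
  -- integrability of the pieces
  have hX2i : Integrable (fun z : ℕ → Ω × Ω => (f ((z k).2) - m) ^ 2) P :=
    integrable_of_bounded P (hXm.pow_const 2) (C := (c - a) ^ 2) (fun z => by
      rw [abs_pow]; exact pow_le_pow_left₀ (abs_nonneg _) (hXb _) 2)
  have hXTi : Integrable (fun z : ℕ → Ω × Ω =>
      |f ((z k).2) - m| * ∑ n ∈ range N, |f ((z (k + n)).1) - f ((z (k + n)).2)|) P :=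
    integrable_of_bounded P (hXm.abs.mul hTm) (C := (c - a) * (N * (c - a))) (fun z => by
      rw [abs_mul, abs_abs, abs_of_nonneg (hTnn z)]
      exact mul_le_mul (hXb _) (hTb z) (hTnn z) hca)
  have hT2i : Integrable (fun z : ℕ → Ω × Ω => (∑ n ∈ range N, |f ((z (k + n)).1) - f ((z (k + n)).2)|) ^ 2) P :=
    integrable_of_bounded P (hTm.pow_const 2) (C := (N * (c - a)) ^ 2) (fun z => by
      rw [abs_pow, abs_of_nonneg (hTnn z)]; exact pow_le_pow_left₀ (hTnn z) (hTb z) 2)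
  have hLi : Integrable (fun z : ℕ → Ω × Ω =>
      (f ((z k).2) + ∑ n ∈ range N, (f ((z (k + n)).1) - f ((z (k + n)).2)) - m) ^ 2) P :=
    integrable_of_bounded P (((hf.comp (measurable_snd.comp (measurable_pi_apply k))).add hSm).sub
      measurable_const |>.pow_const 2) (C := ((c - a) + N * (c - a)) ^ 2) (fun z => by
      rw [abs_pow]
      refine pow_le_pow_left₀ (abs_nonneg _) ?_ 2
      have : f ((z k).2) + ∑ n ∈ range N, (f ((z (k + n)).1) - f ((z (k + n)).2)) - m =
          (f ((z k).2) - m) + ∑ n ∈ range N, (f ((z (k + n)).1) - f ((z (k + n)).2)) := by ring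
      rw [this]
      exact (abs_add_le _ _).trans (add_le_add (hXb _) ((hST z).trans (hTb z))))
  -- pointwise: `(X + S)² ≤ X² + 2|X|·T + T²`
  have hpt : ∀ z : ℕ → Ω × Ω,
      (f ((z k).2) + ∑ n ∈ range N, (f ((z (k + n)).1) - f ((z (k + n)).2)) - m) ^ 2 ≤
        (f ((z k).2) - m) ^ 2 +
          2 * (|f ((z k).2) - m| * ∑ n ∈ range N, |f ((z (k + n)).1) - f ((z (k + n)).2)|) +
          (∑ n ∈ range N, |f ((z (k + n)).1) - f ((z (k + n)).2)|) ^ 2 := by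
    intro z
    have h1 : (f ((z k).2) - m) * ∑ n ∈ range N, (f ((z (k + n)).1) - f ((z (k + n)).2)) ≤
        |f ((z k).2) - m| * ∑ n ∈ range N, |f ((z (k + n)).1) - f ((z (k + n)).2)| := by
      refine (le_abs_self _).trans ?_
      rw [abs_mul]
      exact mul_le_mul_of_nonneg_left (hST z) (abs_nonneg _)
    have h2 : (∑ n ∈ range N, (f ((z (k + n)).1) - f ((z (k + n)).2))) ^ 2 ≤
        (∑ n ∈ range N, |f ((z (k + n)).1) - f ((z (k + n)).2)|) ^ 2 := by
      rw [← sq_abs]; exact pow_le_pow_left₀ (abs_nonneg _) (hST z) 2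
    nlinarith [h1, h2]
  -- the three expectations
  have hE1 : ∫ z, (f ((z k).2) - m) ^ 2 ∂P =
      ∫ y, (f y - m) ^ 2 ∂((fun m : Measure Ω => m.bind (indepMH q w))^[k] (μ₀.map Prod.snd)) :=
    crnLag_integral_snd_eq hw0 Khat hK μ₀ (f := fun y => (f y - m) ^ 2) ((hf.sub measurable_const).pow_const 2)
      (C := (c - a) ^ 2) (fun y => by rw [abs_pow]; exact pow_le_pow_left₀ (abs_nonneg _) (hXb y) 2) k
  have hE2 : ∫ z, |f ((z k).2) - m| * ∑ n ∈ range N, |f ((z (k + n)).1) - f ((z (k + n)).2)| ∂P ≤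
      (1 - (w x₀)⁻¹) ^ k * (c - a) ^ 2 * w x₀ := by
    have hDi : ∀ n, Integrable (fun z : ℕ → Ω × Ω => |f ((z n).1) - f ((z n).2)|) P := fun n =>
      integrable_of_bounded P (hDm' n).abs (fun z => by rw [abs_abs]; exact hDb n z)
    calc ∫ z, |f ((z k).2) - m| * ∑ n ∈ range N, |f ((z (k + n)).1) - f ((z (k + n)).2)| ∂P
        ≤ ∫ z, (c - a) * ∑ n ∈ range N, |f ((z (k + n)).1) - f ((z (k + n)).2)| ∂P :=
          integral_mono hXTi ((integrable_finsetSum _ fun n _ => hDi (k + n)).const_mul _)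
            (fun z => mul_le_mul_of_nonneg_right (hXb _) (hTnn z))
      _ = (c - a) * ∑ n ∈ range N, ∫ z, |f ((z (k + n)).1) - f ((z (k + n)).2)| ∂P := by
          rw [integral_const_mul, integral_finsetSum _ fun n _ => hDi (k + n)]
      _ ≤ (c - a) * ∑ n ∈ range N, (1 - (w x₀)⁻¹) ^ (k + n) * (c - a) :=
          mul_le_mul_of_nonneg_left (sum_le_sum fun n _ =>
            crnLag_integral_abs_diff_le hw0 hmax Khat hK μ₀ hf ha hc (k + n)) hca
      _ = (1 - (w x₀)⁻¹) ^ k * (c - a) ^ 2 * ∑ n ∈ range N, (1 - (w x₀)⁻¹) ^ n := by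
          rw [mul_sum, mul_sum]
          refine sum_congr rfl fun n _ => ?_
          rw [pow_add]; ring
      _ ≤ (1 - (w x₀)⁻¹) ^ k * (c - a) ^ 2 * (1 - (1 - (w x₀)⁻¹))⁻¹ :=
          mul_le_mul_of_nonneg_left (sum_le_hasSum (range N) (fun n _ => pow_nonneg hr0 n)
            (hasSum_geometric_of_lt_one hr0 hr1)) (by positivity)
      _ = (1 - (w x₀)⁻¹) ^ k * (c - a) ^ 2 * w x₀ := by rw [sub_sub_cancel, inv_inv]
  have hE3 := crnLag_integral_sq_sum_abs_le hw0 hmax Khat hK μ₀ hf ha hc k N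
  have h12 : Integrable (fun z : ℕ → Ω × Ω => (f ((z k).2) - m) ^ 2 +
      2 * (|f ((z k).2) - m| * ∑ n ∈ range N, |f ((z (k + n)).1) - f ((z (k + n)).2)|)) P :=
    hX2i.add (hXTi.const_mul 2)
  have h123 : Integrable (fun z : ℕ → Ω × Ω => (f ((z k).2) - m) ^ 2 +
      2 * (|f ((z k).2) - m| * ∑ n ∈ range N, |f ((z (k + n)).1) - f ((z (k + n)).2)|) +
      (∑ n ∈ range N, |f ((z (k + n)).1) - f ((z (k + n)).2)|) ^ 2) P := h12.add hT2i
  calc ∫ z, (f ((z k).2) + ∑ n ∈ range N, (f ((z (k + n)).1) - f ((z (k + n)).2)) - m) ^ 2 ∂P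
      ≤ ∫ z, ((f ((z k).2) - m) ^ 2 +
          2 * (|f ((z k).2) - m| * ∑ n ∈ range N, |f ((z (k + n)).1) - f ((z (k + n)).2)|) +
          (∑ n ∈ range N, |f ((z (k + n)).1) - f ((z (k + n)).2)|) ^ 2) ∂P :=
        integral_mono hLi h123 hpt
    _ = ∫ z, (f ((z k).2) - m) ^ 2 ∂P +
          2 * ∫ z, |f ((z k).2) - m| * ∑ n ∈ range N, |f ((z (k + n)).1) - f ((z (k + n)).2)| ∂P +
          ∫ z, (∑ n ∈ range N, |f ((z (k + n)).1) - f ((z (k + n)).2)|) ^ 2 ∂P := by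
        rw [integral_add h12 hT2i, integral_add hX2i (hXTi.const_mul 2), integral_const_mul]
    _ ≤ ∫ y, (f y - m) ^ 2 ∂((fun m : Measure Ω => m.bind (indepMH q w))^[k] (μ₀.map Prod.snd)) +
          2 * ((1 - (w x₀)⁻¹) ^ k * (c - a) ^ 2 * w x₀) + (1 - (w x₀)⁻¹) ^ k * (c - a) ^ 2 * (w x₀ * (2 * w x₀ - 1)) := by
        rw [hE1]
        exact add_le_add (add_le_add le_rfl (mul_le_mul_of_nonneg_left hE2 zero_le_two)) hE3
    _ = _ := by ring


/-! ## §2 The single-time error from every start -/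

/-- **THE SINGLE-TIME MEAN-SQUARE ERROR FROM EVERY START**: `w` measurable, positive, normalised, maximal at `x₀`
(`r = 1 − 1/w(x₀)`); `a ≤ f ≤ c` measurable, `m = π(f)`.  For every initial law `μ₀` and every `n`:
`∫ (f − m)² d(μ₀Kⁿ) ∈ [(1 − rⁿ)·∫ (f − m)² dπ, (1 − rⁿ)·∫ (f − m)² dπ + rⁿ·max(m − a, c − m)²]`. [ours] -/
theorem integral_sq_sub_iterate_bind_indepMH_mem_Icc (hw : Measurable w) (hw0 : ∀ y, 0 < w y) {x₀ : Ω}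
    (hmax : ∀ y, w y ≤ w x₀) [IsProbabilityMeasure (q.withDensity fun y => ENNReal.ofReal (w y))]
    (n : ℕ) (μ₀ : Measure Ω) [IsProbabilityMeasure μ₀] {f : Ω → ℝ} (hf : Measurable f) {a c : ℝ}
    (ha : ∀ x, a ≤ f x) (hc : ∀ x, f x ≤ c) :
    ∫ y, (f y - ∫ x, f x ∂(q.withDensity fun y => ENNReal.ofReal (w y))) ^ 2
        ∂((fun m : Measure Ω => m.bind (indepMH q w))^[n] μ₀) ∈
      Set.Icc ((1 - (1 - (w x₀)⁻¹) ^ n) *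
          ∫ y, (f y - ∫ x, f x ∂(q.withDensity fun y => ENNReal.ofReal (w y))) ^ 2
            ∂(q.withDensity fun y => ENNReal.ofReal (w y)))
        ((1 - (1 - (w x₀)⁻¹) ^ n) *
          ∫ y, (f y - ∫ x, f x ∂(q.withDensity fun y => ENNReal.ofReal (w y))) ^ 2
            ∂(q.withDensity fun y => ENNReal.ofReal (w y)) +
          (1 - (w x₀)⁻¹) ^ n *
            max (∫ x, f x ∂(q.withDensity fun y => ENNReal.ofReal (w y)) - a)
              (c - ∫ x, f x ∂(q.withDensity fun y => ENNReal.ofReal (w y))) ^ 2) := by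
  haveI : Fact (Measurable w) := ⟨hw⟩
  obtain ⟨ν, hν, h⟩ := exists_iterate_bind_indepMH_eq_mixture (q := q) hw hw0 hmax n μ₀
  set π : Measure Ω := q.withDensity fun y => ENNReal.ofReal (w y) with hπ
  set m : ℝ := ∫ x, f x ∂π with hm
  have hW : 1 ≤ w x₀ := one_le_of_mode (q := q) hmax
  have hr0 : 0 ≤ 1 - (w x₀)⁻¹ := sub_nonneg.2 (inv_le_one_of_one_le₀ hW)
  have hr1 : 1 - (w x₀)⁻¹ ≤ 1 := sub_le_self _ (inv_nonneg.mpr (hw0 x₀).le)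
  have hc0 : 0 ≤ 1 - (1 - (w x₀)⁻¹) ^ n := sub_nonneg.2 (pow_le_one₀ hr0 hr1)
  have hC : ∀ x, |f x| ≤ max |a| |c| := fun x => abs_le_max_abs_abs (ha x) (hc x)
  have hfi : Integrable f π := integrable_of_bounded π hf hC
  have hma : a ≤ m := by
    have := integral_mono (integrable_const a) hfi ha; rwa [integral_const, probReal_univ, one_smul] at this
  have hmc : m ≤ c := by
    have := integral_mono hfi (integrable_const c) hc; rwa [integral_const, probReal_univ, one_smul] at this
  -- `0 ≤ (f − m)² ≤ D²`
  have hgb : ∀ y, (f y - m) ^ 2 ≤ max (m - a) (c - m) ^ 2 := by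
    intro y
    rw [← sq_abs]
    refine pow_le_pow_left₀ (abs_nonneg _) (abs_le.2 ⟨?_, ?_⟩) 2
    · have := le_max_left (m - a) (c - m); have := ha y; linarith
    · have := le_max_right (m - a) (c - m); have := hc y; linarith
  have hgm : Measurable (fun y => (f y - m) ^ 2) := (hf.sub measurable_const).pow_const 2
  have hgi : ∀ (μ : Measure Ω) [IsProbabilityMeasure μ], Integrable (fun y => (f y - m) ^ 2) μ := fun μ _ =>
    integrable_of_bounded μ hgm (C := max (m - a) (c - m) ^ 2) (fun y => by
      rw [abs_of_nonneg (sq_nonneg _)]; exact hgb y)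
  rw [h, integral_add_measure ((hgi π).smul_measure ENNReal.ofReal_ne_top)
      ((hgi ν).smul_measure ENNReal.ofReal_ne_top),
    integral_smul_measure, integral_smul_measure, ENNReal.toReal_ofReal hc0,
    ENNReal.toReal_ofReal (pow_nonneg hr0 n), smul_eq_mul, smul_eq_mul]
  have hν0 : 0 ≤ ∫ y, (f y - m) ^ 2 ∂ν := integral_nonneg fun y => sq_nonneg _
  have hνD : ∫ y, (f y - m) ^ 2 ∂ν ≤ max (m - a) (c - m) ^ 2 := by
    have := integral_mono (hgi ν) (integrable_const _) hgb
    rwa [integral_const, probReal_univ, one_smul] at this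
  constructor <;> nlinarith [pow_nonneg hr0 n]

/-- **`∫ (f − π f)² d(μ₀Kⁿ) ≤ Var_π f + rⁿ·D²`** from every start (`D = max(π f − a, c − π f)`). [ours] -/
theorem integral_sq_sub_iterate_bind_indepMH_le (hw : Measurable w) (hw0 : ∀ y, 0 < w y) {x₀ : Ω}
    (hmax : ∀ y, w y ≤ w x₀) [IsProbabilityMeasure (q.withDensity fun y => ENNReal.ofReal (w y))]
    (n : ℕ) (μ₀ : Measure Ω) [IsProbabilityMeasure μ₀] {f : Ω → ℝ} (hf : Measurable f) {a c : ℝ}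
    (ha : ∀ x, a ≤ f x) (hc : ∀ x, f x ≤ c) :
    ∫ y, (f y - ∫ x, f x ∂(q.withDensity fun y => ENNReal.ofReal (w y))) ^ 2
        ∂((fun m : Measure Ω => m.bind (indepMH q w))^[n] μ₀) ≤
      ∫ y, (f y - ∫ x, f x ∂(q.withDensity fun y => ENNReal.ofReal (w y))) ^ 2
          ∂(q.withDensity fun y => ENNReal.ofReal (w y)) +
        (1 - (w x₀)⁻¹) ^ n *
          max (∫ x, f x ∂(q.withDensity fun y => ENNReal.ofReal (w y)) - a)
            (c - ∫ x, f x ∂(q.withDensity fun y => ENNReal.ofReal (w y))) ^ 2 := by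
  obtain ⟨-, h2⟩ := integral_sq_sub_iterate_bind_indepMH_mem_Icc (q := q) hw hw0 hmax n μ₀ hf ha hc
  have hW : 1 ≤ w x₀ := one_le_of_mode (q := q) hmax
  have hr0 : 0 ≤ 1 - (w x₀)⁻¹ := sub_nonneg.2 (inv_le_one_of_one_le₀ hW)
  have hV : 0 ≤ ∫ y, (f y - ∫ x, f x ∂(q.withDensity fun y => ENNReal.ofReal (w y))) ^ 2
      ∂(q.withDensity fun y => ENNReal.ofReal (w y)) := integral_nonneg fun y => sq_nonneg _
  nlinarith [pow_nonneg hr0 n]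

/-! ## §3 The mean-square error of the coupled estimator from every start -/

/-- **THE MEAN-SQUARE ERROR OF THE COUPLED ESTIMATOR FROM EVERY START**: `w` measurable (a `Fact`), positive, normalised,
maximal at `x₀` (`W = w(x₀)`, `r = 1 − 1/W`); `K̂` a CRN pair kernel; `a ≤ f ≤ c` measurable, `D = max(π f − a, c − π f)`; every
initial coupling `μ̂₀`, every `k`, `N`:
`E(f(Y_k) + Σ_{n<N} D_{k+n} − π f)² ≤ (1 − r^k)·Var_π f + r^k·(D² + (c − a)²·W(2W + 1))`. [ours] -/
theorem crnLag_truncated_sq_le_variance [Fact (Measurable w)] (hw0 : ∀ y, 0 < w y) {x₀ : Ω} (hmax : ∀ y, w y ≤ w x₀)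
    [IsProbabilityMeasure (q.withDensity fun y => ENNReal.ofReal (w y))]
    (Khat : Kernel (Ω × Ω) (Ω × Ω)) [IsMarkovKernel Khat]
    (hK : ∀ z : Ω × Ω, Khat z = (q.prod (volume : Measure unitInterval)).map (fun p : Ω × unitInterval =>
      ((if (p.2 : ℝ) * w z.1 ≤ w p.1 then p.1 else z.1), (if (p.2 : ℝ) * w z.2 ≤ w p.1 then p.1 else z.2))))
    (μ₀ : Measure (Ω × Ω)) [IsProbabilityMeasure μ₀] {f : Ω → ℝ} (hf : Measurable f) {a c : ℝ}
    (ha : ∀ x, a ≤ f x) (hc : ∀ x, f x ≤ c) (k N : ℕ) :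
    ∫ z, (f ((z k).2) + ∑ n ∈ Finset.range N, (f ((z (k + n)).1) - f ((z (k + n)).2)) -
          ∫ x, f x ∂(q.withDensity fun y => ENNReal.ofReal (w y))) ^ 2
        ∂(Kernel.trajMeasure (X := fun _ : ℕ => Ω × Ω) μ₀
          (fun n : ℕ => Khat.comap (fun h : (i : ↥(Finset.Iic n)) → Ω × Ω => h ⟨n, Finset.mem_Iic.2 le_rfl⟩)
            (measurable_pi_apply _))) ≤
      (1 - (1 - (w x₀)⁻¹) ^ k) *
          ∫ y, (f y - ∫ x, f x ∂(q.withDensity fun y => ENNReal.ofReal (w y))) ^ 2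
            ∂(q.withDensity fun y => ENNReal.ofReal (w y)) +
        (1 - (w x₀)⁻¹) ^ k *
          (max (∫ x, f x ∂(q.withDensity fun y => ENNReal.ofReal (w y)) - a)
              (c - ∫ x, f x ∂(q.withDensity fun y => ENNReal.ofReal (w y))) ^ 2 +
            (c - a) ^ 2 * (w x₀ * (2 * w x₀ + 1))) := by
  haveI : IsProbabilityMeasure (μ₀.map Prod.snd) := Measure.isProbabilityMeasure_map measurable_snd.aemeasurable
  have h1 := crnLag_truncated_sq_le hw0 hmax Khat hK μ₀ hf ha hc k N
  obtain ⟨-, h2⟩ := integral_sq_sub_iterate_bind_indepMH_mem_Icc (q := q) Fact.out hw0 hmax k (μ₀.map Prod.snd) hf ha hc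
  linarith

/-- **`E(H_{k,N} − π f)² ≤ Var_π f + r^k·(c − a)²·(2W² + W + 1)`** from every initial coupling (`D ≤ c − a`, `r^k Var ≥ 0`). [ours] -/
theorem crnLag_truncated_sq_le_variance' [Fact (Measurable w)] (hw0 : ∀ y, 0 < w y) {x₀ : Ω} (hmax : ∀ y, w y ≤ w x₀)
    [IsProbabilityMeasure (q.withDensity fun y => ENNReal.ofReal (w y))]
    (Khat : Kernel (Ω × Ω) (Ω × Ω)) [IsMarkovKernel Khat]
    (hK : ∀ z : Ω × Ω, Khat z = (q.prod (volume : Measure unitInterval)).map (fun p : Ω × unitInterval =>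
      ((if (p.2 : ℝ) * w z.1 ≤ w p.1 then p.1 else z.1), (if (p.2 : ℝ) * w z.2 ≤ w p.1 then p.1 else z.2))))
    (μ₀ : Measure (Ω × Ω)) [IsProbabilityMeasure μ₀] {f : Ω → ℝ} (hf : Measurable f) {a c : ℝ}
    (ha : ∀ x, a ≤ f x) (hc : ∀ x, f x ≤ c) (k N : ℕ) :
    ∫ z, (f ((z k).2) + ∑ n ∈ Finset.range N, (f ((z (k + n)).1) - f ((z (k + n)).2)) -
          ∫ x, f x ∂(q.withDensity fun y => ENNReal.ofReal (w y))) ^ 2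
        ∂(Kernel.trajMeasure (X := fun _ : ℕ => Ω × Ω) μ₀
          (fun n : ℕ => Khat.comap (fun h : (i : ↥(Finset.Iic n)) → Ω × Ω => h ⟨n, Finset.mem_Iic.2 le_rfl⟩)
            (measurable_pi_apply _))) ≤
      ∫ y, (f y - ∫ x, f x ∂(q.withDensity fun y => ENNReal.ofReal (w y))) ^ 2
          ∂(q.withDensity fun y => ENNReal.ofReal (w y)) +
        (1 - (w x₀)⁻¹) ^ k * (c - a) ^ 2 * (2 * w x₀ ^ 2 + w x₀ + 1) := by
  have h := crnLag_truncated_sq_le_variance hw0 hmax Khat hK μ₀ hf ha hc k N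
  set π : Measure Ω := q.withDensity fun y => ENNReal.ofReal (w y) with hπ
  set m : ℝ := ∫ x, f x ∂π with hm
  have hW : 1 ≤ w x₀ := one_le_of_mode (q := q) hmax
  have hr0 : 0 ≤ 1 - (w x₀)⁻¹ := sub_nonneg.2 (inv_le_one_of_one_le₀ hW)
  have hrk := pow_nonneg hr0 k
  have hC : ∀ x, |f x| ≤ max |a| |c| := fun x => abs_le_max_abs_abs (ha x) (hc x)
  have hfi : Integrable f π := integrable_of_bounded π hf hC
  have hma : a ≤ m := by
    have := integral_mono (integrable_const a) hfi ha; rwa [integral_const, probReal_univ, one_smul] at this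
  have hmc : m ≤ c := by
    have := integral_mono hfi (integrable_const c) hc; rwa [integral_const, probReal_univ, one_smul] at this
  have hD : max (m - a) (c - m) ^ 2 ≤ (c - a) ^ 2 := by
    refine pow_le_pow_left₀ (le_max_of_le_left (sub_nonneg.2 hma)) (max_le ?_ ?_) 2 <;> linarith
  have hV : 0 ≤ ∫ y, (f y - m) ^ 2 ∂π := integral_nonneg fun y => sq_nonneg _
  nlinarith [mul_nonneg hrk hV, mul_le_mul_of_nonneg_left hD hrk, sq_nonneg (c - a), mul_nonneg hrk (sq_nonneg (c - a))]

/-- **THE LAG THAT BUYS ONE DRAW'S ERROR**: if `log((2W² + W + 1)/ε) ≤ k/W` (`0 < ε`), then from every initial coupling and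
for every `N`: `E(H_{k,N} − π f)² ≤ Var_π f + ε·(c − a)²`. [ours] -/
theorem crnLag_truncated_sq_le_of_log_le [Fact (Measurable w)] (hw0 : ∀ y, 0 < w y) {x₀ : Ω} (hmax : ∀ y, w y ≤ w x₀)
    [IsProbabilityMeasure (q.withDensity fun y => ENNReal.ofReal (w y))]
    (Khat : Kernel (Ω × Ω) (Ω × Ω)) [IsMarkovKernel Khat]
    (hK : ∀ z : Ω × Ω, Khat z = (q.prod (volume : Measure unitInterval)).map (fun p : Ω × unitInterval =>
      ((if (p.2 : ℝ) * w z.1 ≤ w p.1 then p.1 else z.1), (if (p.2 : ℝ) * w z.2 ≤ w p.1 then p.1 else z.2))))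
    (μ₀ : Measure (Ω × Ω)) [IsProbabilityMeasure μ₀] {f : Ω → ℝ} (hf : Measurable f) {a c : ℝ}
    (ha : ∀ x, a ≤ f x) (hc : ∀ x, f x ≤ c) {k : ℕ} (N : ℕ) {ε : ℝ} (hε : 0 < ε)
    (hk : Real.log ((2 * w x₀ ^ 2 + w x₀ + 1) / ε) ≤ k * (w x₀)⁻¹) :
    ∫ z, (f ((z k).2) + ∑ n ∈ Finset.range N, (f ((z (k + n)).1) - f ((z (k + n)).2)) -
          ∫ x, f x ∂(q.withDensity fun y => ENNReal.ofReal (w y))) ^ 2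
        ∂(Kernel.trajMeasure (X := fun _ : ℕ => Ω × Ω) μ₀
          (fun n : ℕ => Khat.comap (fun h : (i : ↥(Finset.Iic n)) → Ω × Ω => h ⟨n, Finset.mem_Iic.2 le_rfl⟩)
            (measurable_pi_apply _))) ≤
      ∫ y, (f y - ∫ x, f x ∂(q.withDensity fun y => ENNReal.ofReal (w y))) ^ 2
          ∂(q.withDensity fun y => ENNReal.ofReal (w y)) + ε * (c - a) ^ 2 := by
  have h := crnLag_truncated_sq_le_variance' hw0 hmax Khat hK μ₀ hf ha hc k N
  have hW : 1 ≤ w x₀ := one_le_of_mode (q := q) hmax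
  have hWpos : 0 < w x₀ := hw0 x₀
  have hr0 : 0 ≤ 1 - (w x₀)⁻¹ := sub_nonneg.2 (inv_le_one_of_one_le₀ hW)
  have hCpos : 0 < 2 * w x₀ ^ 2 + w x₀ + 1 := by positivity
  -- `r^k ≤ exp(−k/W) ≤ ε/(2W² + W + 1)`
  have hrk : (1 - (w x₀)⁻¹) ^ k * (2 * w x₀ ^ 2 + w x₀ + 1) ≤ ε := by
    have h1 : (1 - (w x₀)⁻¹) ^ k ≤ Real.exp (-(k * (w x₀)⁻¹)) := by
      calc (1 - (w x₀)⁻¹) ^ k ≤ Real.exp (-(w x₀)⁻¹) ^ k := by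
            refine pow_le_pow_left₀ hr0 ?_ k
            have := Real.add_one_le_exp (-(w x₀)⁻¹)
            linarith
        _ = Real.exp (-(k * (w x₀)⁻¹)) := by rw [← Real.exp_nat_mul]; ring_nf
    have h2 : Real.exp (-(k * (w x₀)⁻¹)) ≤ ε / (2 * w x₀ ^ 2 + w x₀ + 1) := by
      calc Real.exp (-(k * (w x₀)⁻¹)) ≤ Real.exp (-Real.log ((2 * w x₀ ^ 2 + w x₀ + 1) / ε)) :=
            Real.exp_le_exp.2 (neg_le_neg hk)
        _ = ε / (2 * w x₀ ^ 2 + w x₀ + 1) := by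
            rw [Real.exp_neg, Real.exp_log (by positivity), inv_div]
    have := (h1.trans h2)
    rwa [le_div_iff₀ hCpos] at this
  nlinarith [sq_nonneg (c - a), mul_le_mul_of_nonneg_left hrk (sq_nonneg (c - a))]

/-- **FROM EVERY STARTING CONFIGURATION `x`** (`Y_0 = x`, `X′_0` one independent update out of `x`, then shared proposals and
uniforms): `E(f(Y_k) + Σ_{n<N} D_{k+n} − π f)² ≤ Var_π f + r^k·(c − a)²·(2W² + W + 1)`. [ours] -/
theorem crnLag_truncated_sq_le_dirac [Fact (Measurable w)] (hw0 : ∀ y, 0 < w y) {x₀ : Ω} (hmax : ∀ y, w y ≤ w x₀)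
    [IsProbabilityMeasure (q.withDensity fun y => ENNReal.ofReal (w y))]
    (Khat : Kernel (Ω × Ω) (Ω × Ω)) [IsMarkovKernel Khat]
    (hK : ∀ z : Ω × Ω, Khat z = (q.prod (volume : Measure unitInterval)).map (fun p : Ω × unitInterval =>
      ((if (p.2 : ℝ) * w z.1 ≤ w p.1 then p.1 else z.1), (if (p.2 : ℝ) * w z.2 ≤ w p.1 then p.1 else z.2))))
    (x : Ω) {f : Ω → ℝ} (hf : Measurable f) {a c : ℝ} (ha : ∀ x, a ≤ f x) (hc : ∀ x, f x ≤ c) (k N : ℕ) :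
    ∫ z, (f ((z k).2) + ∑ n ∈ Finset.range N, (f ((z (k + n)).1) - f ((z (k + n)).2)) -
          ∫ x, f x ∂(q.withDensity fun y => ENNReal.ofReal (w y))) ^ 2
        ∂(Kernel.trajMeasure (X := fun _ : ℕ => Ω × Ω) (((Measure.dirac x).bind (indepMH q w)).prod (Measure.dirac x))
          (fun n : ℕ => Khat.comap (fun h : (i : ↥(Finset.Iic n)) → Ω × Ω => h ⟨n, Finset.mem_Iic.2 le_rfl⟩)
            (measurable_pi_apply _))) ≤
      ∫ y, (f y - ∫ x, f x ∂(q.withDensity fun y => ENNReal.ofReal (w y))) ^ 2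
          ∂(q.withDensity fun y => ENNReal.ofReal (w y)) +
        (1 - (w x₀)⁻¹) ^ k * (c - a) ^ 2 * (2 * w x₀ ^ 2 + w x₀ + 1) := by
  haveI h1 : IsProbabilityMeasure ((Measure.dirac x).bind (indepMH q w)) :=
    ⟨by rw [Measure.bind_apply MeasurableSet.univ (Kernel.aemeasurable _)]; simp⟩
  exact crnLag_truncated_sq_le_variance' hw0 hmax Khat hK _ hf ha hc k N

end Summit.Ventures.LatticeQCDFlow.Exactness

end
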